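import Summits.CriticalPhenomena.PercolationContinuityZ3.Theorems.Transplant.SkelConcFaceKits
import Summits.CriticalPhenomena.PercolationContinuityZ3.Theorems.Transplant.SkelConcFaceInnerKits
import HarnessLib

/-!
# Kozma–Nitzan Lemma 12 over a planar skeleton — the face step's kit clauses with the INNER KITS discharged (hp-8 (F) part E)

builds on p205010 (kernel theorem, internal audit signed; external expert review pending) — nothing in this file uses p205010.
Lane `prim-bschramm`, typed by the `prim-hp-8` lineage (gen 24); helper file (`--supports stmt-CriticalPhenomena-4575 --as helper`).  NEW FILE
over `SkelConcFaceKits` (`hkits_faceStepW'`), `SkelConcFaceContact` (`hroute_face'`), `SkelConcFaceInnerKits` (`innerKits'`).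
* **`hroute_face_kits`** — `hroute_face'` with its inner kit clauses `hkitsA` discharged by `innerKits'` (same proof, one call replaced);
* **`hkits_faceStepW_kits`** — `hkits_faceStepW'` over `hroute_face_kits`: the `hkits` hypothesis of `Skel.faceOblAt_concSG` from the Step-I
  input family (margin `am ≤ min(δ₂², δA²)`), the seed-kit constants (outer and inner counts), the rim numerics, the inner-run numerics,
  the route scales `[ℓ₀, ℓ₁A] ∪ {M, ℓ1} ⊆ Ssc`, the multi-step chain estimate `hchain` and the centre-uniform excess radius.
[cite: KozmaNitzan2024, §4 Lemma 10 Steps III–V (pp. 19–22), Lemma 11 (pp. 22–23), Lemma 12 (p. 24), p. 30]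
-/

noncomputable section

open MeasureTheory
open scoped Classical

namespace Summit.CriticalPhenomena.PercolationContinuityZ3.Theorems

namespace Transplant

namespace Skel

open Literature.Probability.Percolation Literature.Probability.LatticeModels SimpleGraph KNCells KNLevels GadgetSystem Contour ChainPlanar
open Literature.Probability.Percolation.KozmaNitzan
open Literature.Probability.Percolation.KozmaNitzan.Cells (oth oth_ne sgOf sgOf_sign stepVec_apply_fst stepVec_apply_oth eq_oth_of_ne oth_oth)
open Literature.Probability.Percolation.GM (HOct)
open Literature.Barriers.CriticalPhenomena (graphBall graphBall_finite mem_graphBall_self graphBall_mono)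
open BoxProdZ2 (ConcRadiiG InnerRunOK innerCtr innerρ)
open PlanarSkeletonConc
open SkelI (tanOff deepCtr exitDir cubeU)

variable {V : Type} [DecidableEq V] [Countable V] {G : SimpleGraph V} [G.LocallyFinite] (Φ : PlanarSkeletonConc G)

/-! ## §1 The route clause at a deep contact, inner kits discharged -/

/-- **The route clause at a deep contact with the INNER KITS DISCHARGED** (`hroute_face'` ∘ `innerKits'`): the inner elongated route's
kit clauses come from the Step-I family, the seed-kit constants and the rooted run's planar rooms; what remains abstract is the multi-step
chain estimate `hchain` and the centre-uniform excess radius. [cite: KozmaNitzan2024, §4 Lemma 11 (pp. 22–23), Lemma 12 (p. 24)] -/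
theorem hroute_face_kits {C : PCells} {x : Site 2} {du : MDir} {j : ℕ} (hjK : j + 1 ≤ C.K)
    {p : unitInterval} (hC : Φ.toPlanarSkeleton.CylSubcritical p)
    -- the inner-run constants
    {s₁ R' ℓ₀ ℓ1 Rlev M nmax j₀A RlevA N L_A L'_A : ℕ} (hMℓ : M < ℓ₀) (hs : R' + ℓ₀ ≤ s₁) (hs2 : 2 * R' ≤ s₁) (hℓ1 : M + s₁ + 2 * R' + 1 ≤ ℓ1)
    (hn : 12 * C.r ≤ nmax * s₁) (hbig : Rlev + ℓ1 + 2 * s₁ + (nmax + 3) * R' ≤ C.r) (h10s : Rlev + ℓ1 + 3 ≤ 10 * C.s)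
    (hRl : RlevA + 1 ≤ R') (hℓL : fatRadius Φ hC ℓ1 ≤ L_A) (hLA : 28 * C.r + 2 * Rlev ≤ L_A)
    {τ : ℤˣ} (hτ : (τ : ℤ) = sgOf du)
    -- the face window and its law
    {w₀ : V} {R R₁' : ℕ} {Λ : ConcRadiiG} {a' : ℕ} (hR₁R : R₁' ≤ R) (hR₁M : R₁' + 1 ≤ Λ.rM a' (x + stepVec du))
    {Wt : Sym2 V → unitInterval} {q : unitInterval} (hWD : IsSubbox (winGraph G w₀ R) Wt q (Φ.Win w₀ (C.farAS x du j) R))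
    (hWG : ∀ e, e ∉ G.edgeSet → Wt e = 0)
    -- the contact's cube centre: footprint in the thickened face row, deep
    {o : V} (hφo : Φ.φ o ∈ Finset.Icc (C.faceLo x du j - (Rlev : Site 2)) (C.faceHi x du j + (Rlev : Site 2)))
    (hdeep : graphBall G o L_A ⊆ graphBall G w₀ R₁') {mₛ : ℕ} (hmM : mₛ ≤ M)
    -- the chain estimate, the count, the inner kits under the route law, the excess radius
    {Δ' : ℕ} {δ ε'' η : ℝ}
    (hchain : ∀ n ≤ nmax, ∀ (Wg : Sym2 V → unitInterval) (s : Fin (n + 1) → TStep (winGraph G o L_A)) (T' : Fin (n + 1) → Finset V) (η : ℝ),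
      (∀ i, (s i).L.o = (s 0).L.o) →
      (∀ i : Fin n, T' (Fin.castSucc i) ⊆ (s i.succ).L.X 0) →
      (∀ i, T' i ⊆ (s i).T) →
      (∀ i, (s i).KitsAt Wg q Δ' δ) →
      η ≤ δ / 2 →
      (∀ i, (prodBernoulli Wg).real (⋃ t ∈ (s i).T \ T' i, openConn (s 0).L.o t) ≤ η) →
      1 - δ < (prodBernoulli Wg).real (s 0).L.reachB →
        1 - ε'' < (prodBernoulli Wg).real (⋃ t ∈ T' (Fin.last n), openConn (s 0).L.o t))
    (hcount : 1 / (1 - (q : ℝ)) ^ (Δ' * N) ≤ δ * ((Finset.Icc j₀A RlevA).card : ℝ))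
    -- the inner kits: Step-I family (margin `am ≤ δ²`), kit scale `M ∈ Ssc`, route scales `[ℓ₀, ℓ₁A] ⊆ Ssc`, seed-kit constants, counts
    (msel : V → ℕ) {Ssc : Finset ℕ} {am : ℝ} (hδ : 0 < δ) (ham : am ≤ δ ^ 2)
    (hin : ∀ i ∈ inputIndex Φ Ssc, 1 - am < (bondPercolation G q).real (inputEvent Φ hC msel i))
    (hMS : M ∈ Ssc) (hmsel : ∀ t ∈ Φ.types, msel t ≤ M) {ℓ₁A : ℕ} (hℓ₁A : (s₁ : ℤ) + R' ≤ ℓ₁A)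
    (hSsc : ∀ ℓ, ℓ₀ ≤ ℓ → ℓ ≤ ℓ₁A → ℓ ∈ Ssc)
    {ℓs Rsd r₀ rs kk : ℕ} (hMℓs : M + 1 ≤ ℓs) (hj₀ : SkelI.tanOff ℓs M ≤ j₀A)
    (hR'₁ : Φ.cylRadMax ℓs (ℓs + 2 + 2 * SkelI.tanOff ℓs M) ≤ Rsd) (hR'₂ : Φ.cylRadMax ℓs (ℓs + 2 + M + fatRadius Φ hC M) ≤ Rsd)
    (hr₀₁ : ℓs + 1 + SkelI.tanOff ℓs M + Rsd ≤ r₀) (hr₀₂ : 2 * ℓs + 2 + SkelI.tanOff ℓs M + M + fatRadius Φ hC M ≤ r₀) (hr₀L : r₀ ≤ L'_A)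
    (hrs₁ : ℓs + 2 + SkelI.tanOff ℓs M + Rsd ≤ rs) (hrs₂ : 2 * ℓs + 3 + SkelI.tanOff ℓs M + M + fatRadius Φ hC M ≤ rs)
    (hLψ : fatRadius Φ hC ℓ₁A + fatRadius Φ hC M ≤ L'_A) (hLR' : L'_A ≤ L_A)
    (hN : kk * (Φ.Δ + 1) ^ (2 * rs) ≤ N)
    (hkk : (1 - (q : ℝ) ^ (1 + Φ.Δ * ((Φ.Δ + 1) ^ Rsd + (SkelI.tanOff ℓs M + 2)) +
      ((Φ.Δ + 1) ^ Rsd + (SkelI.tanOff ℓs M + 2)) * (Φ.Δ + 1) ^ fatRadius Φ hC M)) ^ kk ≤ δ)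
    (hη : η ≤ δ / 2) {R₁ : ℕ}
    (hR₁ : ∀ (c' : V) (R'' : ℕ), R₁ ≤ R'' → ∀ (Rw : ℕ) (D' A' : Finset V), (∀ d ∈ D', d ∈ graphBall G c' Rw) →
      (∀ d ∈ D', ∀ d' ∈ D', Φ.φ d - Φ.φ d' ∈ box 2 (50 * C.r)) → A' ⊆ D' → (∀ a ∈ A', a ∈ graphBall G c' (2 * fatRadius Φ hC M)) →
        (bondPercolation G q).real (excess G c' R'' D' A') ≤ η)
    (hR : R₁ ≤ L_A - L'_A)
    -- the fine first-hop link input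
    (hlink : 1 - δ < (bondPercolation G q).real
      (linkIn (↑(fatSeq Φ hC o ℓ1)) (fatSeq Φ hC o mₛ) (macroPiece Φ o ℓ1 (fatRadius Φ hC ℓ1) (faceElt du.1 τ)))) :
    ∃ Qt Ft : Finset V, Ft ⊆ (cellGeomSG Φ C w₀ Λ).M a' (x + stepVec du) ∧ Qt ⊆ Φ.Win w₀ (C.farAS x du j) R ∧
      (∀ u ∈ Qt, ∀ v ∈ Qt, G.Adj u v → (winGraph G w₀ R).Adj u v) ∧ Disjoint Ft (fatSeq Φ hC o M) ∧
      1 - ε'' < (prodBernoulli Wt).real (linkIn (↑Qt : Set V) (fatSeq Φ hC o mₛ) Ft) := by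
  -- the inner run through the contact's cube centre
  obtain ⟨ho1, ho2, hob⟩ := lev_of_mem_faceRow_thicken C x du j Rlev hφo
  have hlv1 : 5 * (C.r : ℤ) + 10 * C.s * (j + 1 : ℕ) - 1 - Rlev ≤ C.lev du x (Φ.φ o) := by unfold PCells.faceL at ho1; push_cast at ho1 ⊢; linarith
  have hlv2 : C.lev du x (Φ.φ o) ≤ 5 * (C.r : ℤ) + 10 * C.s * (j + 1 : ℕ) - 1 + Rlev := by unfold PCells.faceL at ho2; push_cast at ho2 ⊢; linarith
  obtain ⟨hOK, hnA, ⟨hlo₂, htr₂⟩, ⟨h1, h2, h3, h4⟩, hsepM⟩ :=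
    PCells.innerRunOK_contact_shifted C hjK hMℓ hs hs2 hℓ1 hn hbig h10s hlv1 hlv2 hob
  have hballR : graphBall G o L_A ⊆ graphBall G w₀ R := hdeep.trans (graphBall_mono G w₀ hR₁R)
  have h3' : C.cen x (oth du.1) - (5 * (C.r : ℤ) - 2) ≤ Φ.φ o (oth du.1) - ℓ1 := by linarith
  have h4' : Φ.φ o (oth du.1) + ℓ1 ≤ C.cen x (oth du.1) + (5 * (C.r : ℤ) - 2) := by linarith
  have hQ : innerQt Φ C x du o L_A s₁ R' ((17 * (C.r : ℤ) - (C.lev du x (Φ.φ o) + ℓ1)).toNat / s₁) (C.lev du x (Φ.φ o) + ℓ1) (Φ.φ o (oth du.1) - C.cen x (oth du.1)) ℓ1 (Φ.φ o) ℓ1 ⊆ Φ.Win w₀ (C.farAS x du j) R :=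
    innerQt_subset_Win_farAS Φ hballR hOK hlo₂ htr₂ h1 h2 h3' h4'
  have hQfar : innerQtPl C x du s₁ R' ((17 * (C.r : ℤ) - (C.lev du x (Φ.φ o) + ℓ1)).toNat / s₁) (C.lev du x (Φ.φ o) + ℓ1) (Φ.φ o (oth du.1) - C.cen x (oth du.1)) ℓ1 (Φ.φ o) ℓ1 ⊆ C.farAS x du j :=
    innerQtPl_subset_farAS hOK hlo₂ htr₂ h1 h2 h3' h4'
  have hsep : C.lev du x (Φ.φ o) + mₛ < (C.lev du x (Φ.φ o) + ℓ1) - (s₁ + 2 * R') := by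
    have : (mₛ : ℤ) ≤ M := by exact_mod_cast hmM
    linarith
  -- the cubes about `o` (scales `≤ ℓ1`) miss the far cell's inner square: their levels are `< 17 r`
  have hSm : ∀ m ≤ ℓ1, ∀ z ∈ fatSeq Φ hC o m, Φ.φ z ∉ C.M (x + stepVec du) := by
    intro m hm z hz hzM
    have h17 := PCells.lev_ge_of_mem_M_add C hzM
    have hbox := fatSeq_sub_mem_box Φ hC o m z hz
    rw [mem_box] at hbox
    have hzl := hbox du.1
    rw [Pi.sub_apply] at hzl
    have e1 : -(m : ℤ) ≤ Φ.φ z du.1 - Φ.φ o du.1 ∧ Φ.φ z du.1 - Φ.φ o du.1 ≤ m := by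
      omega
    have hsj : (C.s : ℤ) * (j + 1) ≤ C.r := by
      have h := Nat.mul_le_mul_left C.s hjK
      rw [Nat.mul_comm C.s C.K] at h
      exact_mod_cast (show C.s * (j + 1) ≤ C.r from h)
    unfold PCells.lev at h17 hlv2
    have hbig' : (Rlev : ℤ) + ℓ1 ≤ C.r := by exact_mod_cast (show Rlev + ℓ1 ≤ C.r by omega)
    have hm' : (m : ℤ) ≤ ℓ1 := by exact_mod_cast hm
    push_cast at hlv2
    rcases sgOf_sign du with hsg | hsg <;> rw [hsg] at h17 hlv2 <;> simp only [one_mul, neg_mul] at h17 hlv2 <;> linarith [e1.1, e1.2]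
  refine ⟨innerQt Φ C x du o L_A s₁ R' ((17 * (C.r : ℤ) - (C.lev du x (Φ.φ o) + ℓ1)).toNat / s₁) (C.lev du x (Φ.φ o) + ℓ1) (Φ.φ o (oth du.1) - C.cen x (oth du.1)) ℓ1 (Φ.φ o) ℓ1,
    (innerWAD Φ C x du o L_A L'_A (C.lev du x (Φ.φ o) + ℓ1) (Φ.φ o (oth du.1) - C.cen x (oth du.1)) ℓ1 s₁ R' ℓ₀ ((17 * (C.r : ℤ) - (C.lev du x (Φ.φ o) + ℓ1)).toNat / s₁) RlevA N j₀A RlevA (Φ.Win w₀ (C.farAS x du j) R)).coreT Φ ((17 * (C.r : ℤ) - (C.lev du x (Φ.φ o) + ℓ1)).toNat / s₁),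
    innerWAD_coreT_subset_M Φ hdeep hR₁M hOK, hQ,
    fun u hu v hv huv => (winGraph_adj G).2 ⟨huv, (Φ.mem_Win.1 (hQ hu)).1, (Φ.mem_Win.1 (hQ hv)).1⟩,
    innerWAD_coreT_disjoint Φ hOK (hSm M (by omega)), ?_⟩
  exact innerRoute_link_lt Φ hOK hRl le_rfl (innerWAD_coreT_nonempty Φ hjK hOK hlo₂ htr₂ hφo hLA) hC (hmM.trans (by omega)) hℓL hτ
    rfl rfl rfl hsep (hSm mₛ (by omega)) hWD (fun u hu => (Φ.mem_Win.1 hu).1) hWG hQ hQ hQfar (hchain ((17 * (C.r : ℤ) - (C.lev du x (Φ.φ o) + ℓ1)).toNat / s₁) hnA) hcount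
    (innerKits' Φ hOK hRl le_rfl hC hsep hWD (fun u hu => (Φ.mem_Win.1 hu).1) hWG hQ msel hδ ham hin hMS hmsel hMℓ hℓ₁A hSsc hMℓs hj₀
      hR'₁ hR'₂ hr₀₁ hr₀₂ hr₀L hrs₁ hrs₂ hLψ hLR' hN hkk) hη
    (fun c' R'' hR'' Rw D' A' hD hDD hA hA' => hR₁ c' R'' hR'' Rw D' A' hD hDD hA fun a ha =>
      graphBall_mono G c' (Nat.mul_le_mul_left 2 (fatRadius_mono Φ hC hmM)) (hA' a ha))
    hR hlink

/-! ## §2 The face step's kit clauses, inner kits discharged -/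

section History

variable {C : PCells} {w₀ : V} {Λ : ConcRadiiG} {S : KSchA V ℕ}
variable (hΓ : S.Γ = cellGeomSG Φ C w₀ Λ) (hΛ : WFS C Λ)
variable {h : ProbeHistory V} {e : Site 2 × MDir} (hV : S.Valid₂ G h e) {a a' : ℕ} {du : MDir} (hdu : du ∈ S.onward G h (tgt e))
variable {j : ℕ} {o : Finset (Sym2 V)} (Rlev N Mj L' : ℕ)

include hΓ hΛ hV hdu in
/-- **The face step's kit clauses with the inner kits discharged too** (`hkits_faceStepW'` ∘ `hroute_face_kits`): every kit-level input is now
the Step-I family, constants, counts, the chain estimate `hchain` and the excess radii.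
[cite: KozmaNitzan2024, §4 Lemma 10 Steps III–V (pp. 19–22), Lemma 11 (pp. 22–23), Lemma 12 (p. 24)] -/
theorem hkits_faceStepW_kits (hjK : j + 1 ≤ C.K) (hRlev : Rlev + 3 ≤ 10 * C.s)
    -- the Step-I input family at the running parameter (margin am ≤ δ₂², am ≤ δA) and the kit constants
    {p₀ : unitInterval} (hC : Φ.toPlanarSkeleton.CylSubcritical p₀) (msel : V → ℕ) {Ssc : Finset ℕ} {δ₂ δA am : ℝ} (hδ : 0 < δ₂)
    (ham₂ : am ≤ δ₂ ^ 2) (hin : ∀ i ∈ Skel.inputIndex Φ Ssc, 1 - am < (bondPercolation G S.p).real (Skel.inputEvent Φ hC msel i))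
    {M : ℕ} (hM : M ∈ Ssc) (hmsel : ∀ t ∈ Φ.types, msel t ≤ M) {ℓs R' r₀ rs k : ℕ} (hMℓ : M + 1 ≤ ℓs) (hMj : tanOff ℓs M ≤ Mj + 1)
    (hR'₁ : Φ.cylRadMax ℓs (ℓs + 2 + 2 * tanOff ℓs M) ≤ R') (hR'₂ : Φ.cylRadMax ℓs (ℓs + 2 + M + fatRadius Φ hC M) ≤ R')
    (hr₀₁ : ℓs + 1 + tanOff ℓs M + R' ≤ r₀) (hr₀₂ : 2 * ℓs + 2 + tanOff ℓs M + M + fatRadius Φ hC M ≤ r₀) (hR : r₀ ≤ Λ.rE a' (tgt e) du)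
    (hrs₁ : ℓs + 2 + tanOff ℓs M + R' ≤ rs) (hrs₂ : 2 * ℓs + 3 + tanOff ℓs M + M + fatRadius Φ hC M ≤ rs)
    (hN : k * (Φ.Δ + 1) ^ (2 * rs) ≤ N)
    (hk : (1 - (S.p : ℝ) ^ (1 + Φ.Δ * ((Φ.Δ + 1) ^ R' + (tanOff ℓs M + 2)) +
      ((Φ.Δ + 1) ^ R' + (tanOff ℓs M + 2)) * (Φ.Δ + 1) ^ fatRadius Φ hC M)) ^ k ≤ δ₂)
    -- the rim numerics
    (hL'1 : 1 ≤ L') (hL'M : L' ≤ Λ.rM a' (tgt e + stepVec du)) (hMR : Λ.rM a' (tgt e + stepVec du) ≤ Λ.rE a' (tgt e) du)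
    {L_A : ℕ} (hLd : L_A + fatRadius Φ hC M + 1 ≤ L')
    -- the inner route package (`Skel.hroute_face`) at inner accuracy δA, for every cube centre `oc`
    {s₁ R'ᵢ ℓ₀ ℓ1 nmax j₀A RlevA N_A L'_A : ℕ} (hℓ1S : ℓ1 ∈ Ssc) (hMℓ₀ : M < ℓ₀) (hs : R'ᵢ + ℓ₀ ≤ s₁) (hs2 : 2 * R'ᵢ ≤ s₁)
    (hℓ1 : M + s₁ + 2 * R'ᵢ + 1 ≤ ℓ1) (hn : 12 * C.r ≤ nmax * s₁) (hbig : Rlev + ℓ1 + 2 * s₁ + (nmax + 3) * R'ᵢ ≤ C.r)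
    (h10s : Rlev + ℓ1 + 3 ≤ 10 * C.s) (hRlA : RlevA + 1 ≤ R'ᵢ) (hℓL : fatRadius Φ hC ℓ1 ≤ L_A) (hLA : 28 * C.r + 2 * Rlev ≤ L_A)
    {τ : ℤˣ} (hτ : (τ : ℤ) = sgOf du) {Δ'ᵢ : ℕ} {ηA : ℝ}
    (hchain : ∀ (oc : V), ∀ n ≤ nmax, ∀ (Wg : Sym2 V → unitInterval) (s : Fin (n + 1) → TStep (winGraph G oc L_A)) (T' : Fin (n + 1) → Finset V) (η' : ℝ),
      (∀ i, (s i).L.o = (s 0).L.o) →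
      (∀ i : Fin n, T' (Fin.castSucc i) ⊆ (s i.succ).L.X 0) →
      (∀ i, T' i ⊆ (s i).T) →
      (∀ i, (s i).KitsAt Wg S.p Δ'ᵢ δA) →
      η' ≤ δA / 2 →
      (∀ i, (prodBernoulli Wg).real (⋃ t ∈ (s i).T \ T' i, openConn (s 0).L.o t) ≤ η') →
      1 - δA < (prodBernoulli Wg).real (s 0).L.reachB →
        1 - δ₂ ^ 2 < (prodBernoulli Wg).real (⋃ t ∈ T' (Fin.last n), openConn (s 0).L.o t))
    (hcountA : 1 / (1 - (S.p : ℝ)) ^ (Δ'ᵢ * N_A) ≤ δA * ((Finset.Icc j₀A RlevA).card : ℝ))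
    -- the inner kits at accuracy δA: input margin `am ≤ δA²`, route scales `[ℓ₀, ℓ₁A] ⊆ Ssc`, inner level window above `T₀`, counts
    (hδA : 0 < δA) (hδA1 : δA ≤ 1) (hamA : am ≤ δA ^ 2) {ℓ₁A kkA : ℕ} (hℓ₁A : (s₁ : ℤ) + R'ᵢ ≤ ℓ₁A)
    (hSsc : ∀ ℓ, ℓ₀ ≤ ℓ → ℓ ≤ ℓ₁A → ℓ ∈ Ssc) (hj₀A : tanOff ℓs M ≤ j₀A) (hr₀LA : r₀ ≤ L'_A)
    (hLψA : fatRadius Φ hC ℓ₁A + fatRadius Φ hC M ≤ L'_A) (hLRA : L'_A ≤ L_A) (hNA : kkA * (Φ.Δ + 1) ^ (2 * rs) ≤ N_A)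
    (hkA : (1 - (S.p : ℝ) ^ (1 + Φ.Δ * ((Φ.Δ + 1) ^ R' + (tanOff ℓs M + 2)) +
      ((Φ.Δ + 1) ^ R' + (tanOff ℓs M + 2)) * (Φ.Δ + 1) ^ fatRadius Φ hC M)) ^ kkA ≤ δA)
    (hηA : ηA ≤ δA / 2) {R₁A : ℕ}
    (hR₁A : ∀ (c' : V) (R'' : ℕ), R₁A ≤ R'' → ∀ (Rw : ℕ) (D' A' : Finset V), (∀ d ∈ D', d ∈ graphBall G c' Rw) →
      (∀ d ∈ D', ∀ d' ∈ D', Φ.φ d - Φ.φ d' ∈ box 2 (50 * C.r)) → A' ⊆ D' → (∀ a ∈ A', a ∈ graphBall G c' (2 * fatRadius Φ hC M)) →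
        (bondPercolation G S.p).real (excess G c' R'' D' A') ≤ ηA)
    (hRA : R₁A ≤ L_A - L'_A) :
    let P := faceStepW Φ C w₀ Λ a' (tgt e) du j Rlev N Mj L' (S.Sx G h e a a' du)
    ∀ j' ∈ Finset.Icc P.j₀ P.j₁, ∃ (σ : KNLevels.SData V) (Sz : Finset V),
      KNLevels.SHyp (winLData Φ P.root P.Rπ P.lo P.hi P.root P.Sfin) j' σ ∧ σ.N ≤ P.N ∧
      (1 - (S.p : ℝ) ^ σ.sB) ^ σ.k ≤ δ₂ ∧ Sz ⊆ (winLData Φ P.root P.Rπ P.lo P.hi P.root P.Sfin).X j' ∧ Sz ⊆ P.Rg Φ ∧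
      (∀ x ∈ σ.K, ∀ e' ∈ σ.seed x, e' ∉ wireSet (↑Sz : Set V)) ∧ (∀ x ∈ σ.K, σ.face x ⊆ Sz) ∧
      (∀ x ∈ σ.K, 1 - 3 * δ₂ ≤ (prodBernoulli (S.Wt G h e a a' du j o)).real {ω | ∃ u ∈ σ.face x,
        1 - δ₂ < (prodBernoulli (pinW (S.Wt G h e a a' du j o) (wireSet (↑Sz : Set V)) ω)).real
          (⋃ t ∈ P.T, openConnIn (↑(P.Rg Φ) : Set V) u t)}) := by
  intro P j' hj'
  obtain ⟨hj'0, hj'1⟩ := Finset.mem_Icc.1 hj'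
  change Mj + 1 ≤ j' at hj'0
  change j' ≤ Rlev at hj'1
  have hWD : KNLevels.IsSubbox (winGraph G w₀ (Λ.rE a' (tgt e) du)) (S.Wt G h e a a' du j o) S.p
      (Φ.Win w₀ (C.farAS (tgt e) du j) (Λ.rE a' (tgt e) du)) := isSubbox_faceStepW Φ hΓ hΛ hV hdu Rlev N Mj L'
  have hWG : ∀ e', e' ∉ G.edgeSet → S.Wt G h e a a' du j o e' = 0 := fun e' he => KNCells.KSchA.Wt_eq_zero_of_not_mem_edgeSet he
  have hXD : winLevel Φ w₀ (Λ.rE a' (tgt e) du) (C.faceLo (tgt e) du j) (C.faceHi (tgt e) du j) j' ⊆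
      Φ.Win w₀ (C.farAS (tgt e) du j) (Λ.rE a' (tgt e) du) :=
    winLevel_faceRow_subset_Win Φ (C := C) (w₀ := w₀) (x := tgt e) (du := du) hjK (by omega) _
  have hwide : ∀ i, (C.faceLo (tgt e) du j - (j' : Site 2)) i + 2 * tanOff ℓs M ≤ (C.faceHi (tgt e) du j + (j' : Site 2)) i := by
    intro i
    have h1 := faceRow_hwide C (tgt e) du j (M := Mj) hj'0 i
    have h2 : (tanOff ℓs M : ℤ) ≤ Mj + 1 := by exact_mod_cast hMj
    linarith
  -- the per-contact dichotomy: rim contacts by `hcon_win₂'`, deep contacts by the inner route `hroute_face`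
  have hcon := SkelI.hcon_win₂' Φ hC (msel := msel) (Ssc := Ssc) (q := S.p) (δ := δ₂) (am := am)
    (Wt := S.Wt G h e a a' du j o) (D := Φ.Win w₀ (C.farAS (tgt e) du j) (Λ.rE a' (tgt e) du)) (T := P.T)
    (Rt := Λ.rM a' (tgt e + stepVec du) - 1) (L'' := L' - 1) (Ldeep := L_A) (lo := C.faceLo (tgt e) du j) (hi := C.faceHi (tgt e) du j)
    (j := j') (Unear := SkelI.cubeU Φ hC w₀ (Λ.rE a' (tgt e) du) (C.faceLo (tgt e) du j) (C.faceHi (tgt e) du j) j' ℓs M)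
    (fun _ _ _ => rfl) (SkelI.nearFaceOK_cube Φ hC hMℓ hwide hR'₂ hr₀₂ hR hrs₂ le_rfl) (fun v hv hfar => ?_) (by omega) (by omega) (by omega)
    (fun x' hx' hnear hdeep t ht hin' => ?_)
  · exact SkelI.kitClause_cube' Φ hC msel hδ ham₂ hin hM hmsel hMℓ hwide hR'₁ hR'₂ hr₀₁ hr₀₂ hR hrs₁ hrs₂ k w₀ _ hWD hXD hN hk hcon
  · -- rim vertices are in the enlarged target
    exact Finset.mem_union_right _ (Finset.mem_filter.2 ⟨hXD hv, fun hb => hfar (graphBall_mono G w₀ (by omega) hb)⟩)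
  · -- deep contact: the inner route from the cube centre
    have hctr : cubeCtr Φ (deepCtr Φ w₀ (Λ.rE a' (tgt e) du) (C.faceLo (tgt e) du j - (j' : Site 2)) (C.faceHi (tgt e) du j + (j' : Site 2)) ℓs M x') (exitDir Φ w₀ (Λ.rE a' (tgt e) du) (C.faceLo (tgt e) du j - (j' : Site 2)) (C.faceHi (tgt e) du j + (j' : Site 2)) x').1
        (exitDir Φ w₀ (Λ.rE a' (tgt e) du) (C.faceLo (tgt e) du j - (j' : Site 2)) (C.faceHi (tgt e) du j + (j' : Site 2)) x').2 ℓs M ∈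
        Φ.Win w₀ (Finset.Icc (C.faceLo (tgt e) du j - (j' : Site 2) + ((2 * ℓs + 2 : ℕ) : Site 2))
          (C.faceHi (tgt e) du j + (j' : Site 2) - ((2 * ℓs + 2 : ℕ) : Site 2))) (Λ.rE a' (tgt e) du) :=
      SkelI.cube_subset_shellWin Φ hC hwide hr₀₂ hR hx' hnear ((mem_fatSeq_iff Φ hC).2 (self_mem_cylBall Φ _ M _))
    have hφo := Icc_shrink_subset (C.faceLo (tgt e) du j) (C.faceHi (tgt e) du j) (n := 2 * ℓs + 2) hj'1 (Φ.mem_Win.1 hctr).2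
    have hrM1 : Λ.rM a' (tgt e + stepVec du) - 1 + 1 ≤ Λ.rM a' (tgt e + stepVec du) := by omega
    have hamA' : am ≤ δA := hamA.trans (by nlinarith [hδA.le, hδA1])
    obtain ⟨Qt, Ft, hFt, hQt, hadj, hdisj, hlt⟩ := hroute_face_kits Φ hjK hC hMℓ₀ hs hs2 hℓ1 hn hbig h10s hRlA hℓL hLA hτ
      (R₁' := Λ.rM a' (tgt e + stepVec du) - 1) (by omega) hrM1 hWD hWG
      hφo hdeep (hmsel t ht) (hchain _) hcountA msel hδA hamA hin hM hmsel hℓ₁A hSsc hMℓ hj₀A hR'₁ hR'₂ hr₀₁ hr₀₂ hr₀LA hrs₁ hrs₂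
      hLψA hLRA hNA hkA hηA hR₁A hRA ((sub_le_sub_left hamA' 1).trans_lt ((hin' ℓ1 hℓ1S).2 (faceElt du.1 τ)))
    exact ⟨Qt, Ft, fun v hv => Finset.mem_union_left _ (hFt hv), hQt, hadj, hdisj, hlt⟩

end History

end Skel

end Transplant

end Summit.CriticalPhenomena.PercolationContinuityZ3.Theorems

end
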